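import Literature.NumberTheory.PAdicHodge.TateTraceKernel
import Literature.NumberTheory.PAdicHodge.TateTwistCoboundary
import HarnessLib

/-!
# Tate's `H¹(Gal(F̄/ℚ_p), ℂ_F) = ℚ_p · log χ`: the density-free REDUCTION of a cocycle trivial on `ker χ`
# (Tate 1967 §3.2 Prop. 8, §3.3 Theorem 1 — algebraic half)

Continuation of `TateTraceKernel` (Prop. 7 on `X = \widehat{K_∞}`, `R_n` idempotent and `G₀`-equivariant)
and `TateTwistCoboundary`. Notation as there: `K₀ = PadicBase F p hp ≅ ℚ_p`, `F̄`, `ℂ_F`, `G₀ = Gal(F̄/K₀)`,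
`H = {g ∈ G₀ | g • ζ_{p^M} = ζ_{p^M} ∀ M} = Gal(F̄/K_∞) = ker χ`, `X = \widehat{K_∞}`, `R_n = Rhat n`,
`γ = gen n` (`n ≥ 2`), `ι : K₀ → ℂ_F`. THEOREMS ONLY; no named fact, no `sorry`.

Let `f : G₀ → ℂ_F` be a `1`-COCYCLE (`f(gh) = f(g) + g • f(h)`) VANISHING ON `H` (in Tate's proof: after
subtracting the coboundary given by `H¹(H, ℂ_F) = 0`, tree `TateSenCocycles`). Then:

* `TateH1.mem_X` — every value `f(g)` lies in `X` (`H` is normal and `ℂ_F^H = X`, Ax–Sen–Tate);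
* `TateH1.apply_mul_comm` — `f(gg') = f(g'g)` (`G₀/H` is abelian: all elements act on the `ζ_{p^M}` by
  powers); hence `TateH1.gen_smul_sub_eq` — **`(γ − 1) f(g) = (g − 1) f(γ)`** for all `g`;
* `TateH1.exists_reduce` — **reduction**: there is `x ∈ X ∩ ker R_n` (Prop. 7) such that
  `f₁ = f − ∂x` is again a cocycle vanishing on `H` with `R_n f₁(γ) = f₁(γ)` (`TateH1.sub_coboundary_*`);
* for such a REDUCED cocycle (`R_n f(γ) = f(γ)`): `TateH1.smul_apply_gen_eq` — **`f(γ)` is fixed by ALL of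
  `G₀`** (apply the equivariant idempotent `R_n` to `(γ−1) f(g) = (g−1) f(γ)`: the left side dies), hence
  `TateH1.exists_apply_gen_eq_ι` — `f(γ) = ι r₀`, `r₀ ∈ K₀` (`ℂ_F^{G₀} = K₀`, Ax–Sen–Tate at `L = K₀`);
  `TateH1.gen_smul_apply_eq` — `γ • f(g) = f(g)`; `TateH1.Rhat_apply_eq` — `R_n f(g) = f(g)` for every `g`
  (the estimate on `ker R_n`); `TateH1.apply_gen_pow` — `f(γ^k) = k · f(γ)`.

So a cocycle trivial on `H` is, up to ONE coboundary from `X`, a `γ`-fixed, `R_n`-invariant cocycle whose value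
at `γ` is a SCALAR `r₀ ∈ ℚ_p`. What remains for `H¹_cont(G₀, ℂ_F) = ℚ_p · [log χ]` (NOT here): continuity —
`f = (r₀ / log χ(γ)) · log χ` on `χ⁻¹(1 + p^n ℤ_p)` by density of `γ^ℤ H` — and the finite layer
`Gal(K_n/K₀)` (tree `FiniteLayerCoboundary`).

## References
* J. Tate, *p-divisible groups* (1967), §3.2 Prop. 8, §3.3 Theorem 1. [Tate1967]
* J.-M. Fontaine, Y. Ouyang, *Theory of p-adic Galois representations*, §3.2 Prop. 3.19, Thm. 3.21. [FontaineOuyang2022]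
-/

noncomputable section

open ValuativeRel Field UniformSpace Filter Topology Finset

open scoped IntermediateField

namespace Literature.NumberTheory.PAdicHodge

open Literature.NumberTheory.GaloisRepresentations
open Literature.NumberTheory.GaloisRepresentations.IsNonarchimedeanLocalField
open CyclotomicTower TateTrace

variable {F : Type} [Field F] [ValuativeRel F] [TopologicalSpace F] [IsNonarchimedeanLocalField F]
  [CharZero F] {p : ℕ} [Fact p.Prime] (hp : valuation F p < 1)

namespace TateH1

/-! ### `H = Gal(F̄/K_∞)` is normal with abelian quotient -/

/-- Conjugates of elements of `H` lie in `H`: `(g⁻¹ h g) • ζ_M = ζ_M`. [cite: Tate1967, §3.1] -/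
theorem conj_smul_zeta {g h : BaseGaloisGroup hp} (hh : ∀ M, h • zeta F p M = zeta F p M) (M : ℕ) :
    (g⁻¹ * h * g) • zeta F p M = zeta F p M := by
  obtain ⟨c, -, hc⟩ := exists_smul_zeta_eq hp g M
  rw [mul_smul, mul_smul, hc, smul_pow', hh M, ← hc, inv_smul_smul]

/-- Commutators lie in `H`: `(γ⁻¹ g⁻¹ γ g) • ζ_M = ζ_M` (all of `G₀` acts on `ζ_M` by powers). [cite: Tate1967, §3.1] -/
theorem comm_smul_zeta (g g' : BaseGaloisGroup hp) (M : ℕ) :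
    (g'⁻¹ * g⁻¹ * g' * g) • zeta F p M = zeta F p M := by
  rw [mul_smul, mul_smul, mul_smul, smul_comm_of_mem_K hp g' g (zeta_mem_K hp M), inv_smul_smul, inv_smul_smul]

variable {f : BaseGaloisGroup hp → CompletedAlgClosure F}

/-! ### Values in `X`, and `(γ − 1) f(g) = (g − 1) f(γ)` -/

/-- `f(1) = 0` for a cocycle. [folklore] -/
private theorem apply_one (hcoc : ∀ g h : BaseGaloisGroup hp, f (g * h) = f g + g • f h) : f 1 = 0 := by
  have h := hcoc 1 1
  rw [one_mul, one_smul] at h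
  linear_combination (-1 : CompletedAlgClosure F) * h

/-- Right translation by `H` does not change `f`: `f(g k) = f(g)` for `k ∈ H`. [cite: Tate1967, §3.3] -/
theorem apply_mul_of_mem (hcoc : ∀ g h : BaseGaloisGroup hp, f (g * h) = f g + g • f h)
    (hH : ∀ h : BaseGaloisGroup hp, (∀ M, h • zeta F p M = zeta F p M) → f h = 0)
    (g : BaseGaloisGroup hp) {k : BaseGaloisGroup hp} (hk : ∀ M, k • zeta F p M = zeta F p M) :
    f (g * k) = f g := by
  rw [hcoc, hH k hk, smul_zero, add_zero]

/-- **The values of a cocycle trivial on `H` lie in `X = \widehat{K_∞} = ℂ_F^H`.** [cite: Tate1967, §3.3 Theorem 1] -/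
theorem mem_X (hcoc : ∀ g h : BaseGaloisGroup hp, f (g * h) = f g + g • f h)
    (hH : ∀ h : BaseGaloisGroup hp, (∀ M, h • zeta F p M = zeta F p M) → f h = 0) (g : BaseGaloisGroup hp) :
    f g ∈ X hp := by
  rw [← fixedPoints_eq_X hp]
  intro h hh
  have h1 : f (h * g) = h • f g := by rw [hcoc, hH h hh, zero_add]
  have h2 : f (h * g) = f g := by
    rw [show h * g = g * (g⁻¹ * h * g) by group]
    exact apply_mul_of_mem hp hcoc hH g (conj_smul_zeta hp hh)
  rw [← h1, h2]

/-- **`f(g g') = f(g' g)`** for a cocycle trivial on `H` (the commutator lies in `H`). [cite: Tate1967, §3.3] -/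
theorem apply_mul_comm (hcoc : ∀ g h : BaseGaloisGroup hp, f (g * h) = f g + g • f h)
    (hH : ∀ h : BaseGaloisGroup hp, (∀ M, h • zeta F p M = zeta F p M) → f h = 0) (g g' : BaseGaloisGroup hp) :
    f (g * g') = f (g' * g) := by
  rw [show g * g' = g' * g * (g⁻¹ * g'⁻¹ * g * g') by group]
  exact apply_mul_of_mem hp hcoc hH (g' * g) (comm_smul_zeta hp g' g)

/-- **`(γ − 1) f(g) = (g − 1) f(γ)`** for every `g` (any `γ`; both equal `f(γg) − f(γ) − f(g) = f(gγ) − …`).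
[cite: Tate1967, §3.3 Theorem 1] -/
theorem smul_sub_eq (hcoc : ∀ g h : BaseGaloisGroup hp, f (g * h) = f g + g • f h)
    (hH : ∀ h : BaseGaloisGroup hp, (∀ M, h • zeta F p M = zeta F p M) → f h = 0) (γ g : BaseGaloisGroup hp) :
    γ • f g - f g = g • f γ - f γ := by
  have h1 := hcoc γ g
  have h2 := hcoc g γ
  rw [apply_mul_comm hp hcoc hH γ g] at h1
  linear_combination h1.symm.trans h2

/-! ### Subtracting a coboundary from `X` -/

/-- **`f − ∂x` is again a cocycle**, for any `x` (coboundaries are cocycles). [cite: Tate1967, §3.3 Theorem 1]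
[cite: CasselsFrohlichANT1967, Ch. IV §2 (standard complex, degree 1)] -/
theorem cocycle_sub_coboundary (hcoc : ∀ g h : BaseGaloisGroup hp, f (g * h) = f g + g • f h)
    (x : CompletedAlgClosure F) (g h : BaseGaloisGroup hp) :
    (f (g * h) - ((g * h) • x - x)) = (f g - (g • x - x)) + g • (f h - (h • x - x)) := by
  rw [hcoc, mul_smul, smul_sub, smul_sub]; abel

/-- **`f − ∂x` still vanishes on `H` when `x ∈ X`** (`H` fixes `X` pointwise). [cite: Tate1967, §3.3] -/
theorem sub_coboundary_apply_of_mem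
    (hH : ∀ h : BaseGaloisGroup hp, (∀ M, h • zeta F p M = zeta F p M) → f h = 0)
    {x : CompletedAlgClosure F} (hx : x ∈ X hp) (h : BaseGaloisGroup hp) (hh : ∀ M, h • zeta F p M = zeta F p M) :
    f h - (h • x - x) = 0 := by
  have hfix : h • x = x := by
    have hx' := hx
    rw [← fixedPoints_eq_X hp] at hx'
    exact hx' h hh
  rw [hH h hh, hfix, sub_self, sub_zero]

/-- **Reduction by ONE coboundary from `ker R_n`** (`n ≥ 2`, `γ = gen n`): there is `x ∈ X` with `R_n x = 0`
such that the cocycle `f − ∂x` takes at `γ` the value `R_n f(γ)` — by Prop. 7 applied to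
`f(γ) − R_n f(γ) ∈ ker R_n`. [cite: Tate1967, §3.2 Prop. 7–8] -/
theorem exists_reduce {n : ℕ} (hn : 2 ≤ n) (hcoc : ∀ g h : BaseGaloisGroup hp, f (g * h) = f g + g • f h)
    (hH : ∀ h : BaseGaloisGroup hp, (∀ M, h • zeta F p M = zeta F p M) → f h = 0) :
    ∃ (x : CompletedAlgClosure F) (hx : x ∈ X hp), Rhat hp n ⟨x, hx⟩ = 0 ∧
      f (gen hp n) - (gen hp n • x - x) = Rhat hp n ⟨f (gen hp n), mem_X hp hcoc hH _⟩ := by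
  set a : X hp := ⟨f (gen hp n), mem_X hp hcoc hH _⟩ with ha
  have hmem : (a : CompletedAlgClosure F) - Rhat hp n a ∈ X hp := sub_mem_X hp a.2 (Rhat_mem_X hp hn a)
  have h0 : Rhat hp n ⟨(a : CompletedAlgClosure F) - Rhat hp n a, hmem⟩ = 0 := by
    rw [Rhat_sub hp hn a ⟨Rhat hp n a, Rhat_mem_X hp hn a⟩, Rhat_Rhat hp hn, sub_self]
  obtain ⟨x, hx, hx0, hxa⟩ := exists_gen_smul_sub_eq_of_Rhat_eq_zero hp hn hmem h0
  refine ⟨x, hx, hx0, ?_⟩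
  rw [hxa]
  change f (gen hp n) - (f (gen hp n) - Rhat hp n a) = Rhat hp n a
  abel

/-! ### Reduced cocycles: `f(γ)` is a scalar, `f` is `γ`-fixed and `R_n`-invariant -/

/-- **For a REDUCED cocycle (`R_n f(γ) = f(γ)`), `f(γ)` is fixed by all of `G₀`**: apply `R_n` (idempotent,
additive, `G₀`-equivariant, `R_n ∘ (γ − 1) = 0`) to `(γ − 1) f(g) = (g − 1) f(γ)`.
[cite: Tate1967, §3.2 Prop. 8 and §3.3 Theorem 1] -/
theorem smul_apply_gen_eq {n : ℕ} (hn : 2 ≤ n) (hcoc : ∀ g h : BaseGaloisGroup hp, f (g * h) = f g + g • f h)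
    (hH : ∀ h : BaseGaloisGroup hp, (∀ M, h • zeta F p M = zeta F p M) → f h = 0)
    (hred : Rhat hp n ⟨f (gen hp n), mem_X hp hcoc hH _⟩ = f (gen hp n)) (g : BaseGaloisGroup hp) :
    g • f (gen hp n) = f (gen hp n) := by
  set r : X hp := ⟨f (gen hp n), mem_X hp hcoc hH _⟩ with hr
  set y : X hp := ⟨f g, mem_X hp hcoc hH g⟩ with hy
  -- `R_n((γ−1) y) = 0`
  have h1 : Rhat hp n ⟨gen hp n • (y : CompletedAlgClosure F) - y, sub_mem_X hp (smul_mem_X hp _ y.2) y.2⟩ = 0 :=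
    Rhat_gen_smul_sub_self hp hn y
  -- `(γ−1) y = (g−1) r`
  have h2 : (⟨gen hp n • (y : CompletedAlgClosure F) - y, sub_mem_X hp (smul_mem_X hp _ y.2) y.2⟩ : X hp) =
      ⟨g • (r : CompletedAlgClosure F) - r, sub_mem_X hp (smul_mem_X hp _ r.2) r.2⟩ :=
    Subtype.ext (smul_sub_eq hp hcoc hH (gen hp n) g)
  rw [h2, Rhat_sub hp hn ⟨g • (r : CompletedAlgClosure F), smul_mem_X hp _ r.2⟩ r, Rhat_base_smul hp hn g r] at h1
  change g • Rhat hp n r - Rhat hp n r = 0 at h1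
  rw [hred] at h1
  exact sub_eq_zero.mp h1

/-- **… hence `f(γ) = ι r₀` for a scalar `r₀ ∈ K₀ = ℚ_p`** (`ℂ_F^{G₀} = \widehat{K₀} = K₀`, Ax–Sen–Tate at the
bottom field). [cite: Tate1967, §3.3 Theorem 1] [cite: Ax1970, main Theorem] -/
theorem exists_apply_gen_eq_ι {n : ℕ} (hn : 2 ≤ n) (hcoc : ∀ g h : BaseGaloisGroup hp, f (g * h) = f g + g • f h)
    (hH : ∀ h : BaseGaloisGroup hp, (∀ M, h • zeta F p M = zeta F p M) → f h = 0)
    (hred : Rhat hp n ⟨f (gen hp n), mem_X hp hcoc hH _⟩ = f (gen hp n)) :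
    ∃ r₀ : PadicBase F p hp, f (gen hp n) = ι hp r₀ := by
  have hfix : f (gen hp n) ∈ {x : CompletedAlgClosure F |
      ∀ σ : BaseGaloisGroup hp, (∀ y ∈ (⊥ : IntermediateField (PadicBase F p hp) (NormedAlgClosure F)),
        σ • y = y) → σ • x = x} := fun σ _ => smul_apply_gen_eq hp hn hcoc hH hred σ
  rw [CompletedAlgClosure.fixedPoints_base_eq_closure hp ⊥] at hfix
  -- the image of `K₀` in `ℂ_F` is closed (isometric image of a complete space)
  have hrange : (fun y : NormedAlgClosure F => (y : CompletedAlgClosure F)) ''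
      ((⊥ : IntermediateField (PadicBase F p hp) (NormedAlgClosure F)) : Set (NormedAlgClosure F)) =
      Set.range (ι hp) := by
    ext z
    simp only [Set.mem_image, SetLike.mem_coe, IntermediateField.mem_bot, Set.mem_range]
    constructor
    · rintro ⟨y, ⟨c, rfl⟩, rfl⟩
      exact ⟨c, by rw [ι_def, PadicBase.algebraMap_closure_eq, CompletedAlgClosure.algebraMap_eq_coe]⟩
    · rintro ⟨c, rfl⟩
      exact ⟨algebraMap (PadicBase F p hp) (NormedAlgClosure F) c, ⟨c, rfl⟩,
        by rw [ι_def, PadicBase.algebraMap_closure_eq, CompletedAlgClosure.algebraMap_eq_coe]⟩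
  have hiso : Isometry (ι hp) :=
    AddMonoidHomClass.isometry_of_norm (ιHom hp) (norm_ι hp)
  have hclosed : IsClosed (Set.range (ι hp)) := hiso.isClosedEmbedding.isClosed_range
  rw [hrange, hclosed.closure_eq] at hfix
  obtain ⟨r₀, hr₀⟩ := hfix
  exact ⟨r₀, hr₀.symm⟩

/-- **A reduced cocycle is `γ`-fixed**: `γ • f(g) = f(g)` for all `g`. [cite: Tate1967, §3.3 Theorem 1] -/
theorem gen_smul_apply_eq {n : ℕ} (hn : 2 ≤ n) (hcoc : ∀ g h : BaseGaloisGroup hp, f (g * h) = f g + g • f h)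
    (hH : ∀ h : BaseGaloisGroup hp, (∀ M, h • zeta F p M = zeta F p M) → f h = 0)
    (hred : Rhat hp n ⟨f (gen hp n), mem_X hp hcoc hH _⟩ = f (gen hp n)) (g : BaseGaloisGroup hp) :
    gen hp n • f g = f g := by
  have h := smul_sub_eq hp hcoc hH (gen hp n) g
  rw [smul_apply_gen_eq hp hn hcoc hH hred g, sub_self, sub_eq_zero] at h
  exact h

/-- **A reduced cocycle is `R_n`-invariant**: `R_n f(g) = f(g)` for all `g` (`f(g) − R_n f(g) ∈ ker R_n` is
`γ`-fixed, hence `0` by Tate's estimate). [cite: Tate1967, §3.2 Prop. 7–8] -/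
theorem Rhat_apply_eq {n : ℕ} (hn : 2 ≤ n) (hcoc : ∀ g h : BaseGaloisGroup hp, f (g * h) = f g + g • f h)
    (hH : ∀ h : BaseGaloisGroup hp, (∀ M, h • zeta F p M = zeta F p M) → f h = 0)
    (hred : Rhat hp n ⟨f (gen hp n), mem_X hp hcoc hH _⟩ = f (gen hp n)) (g : BaseGaloisGroup hp) :
    Rhat hp n ⟨f g, mem_X hp hcoc hH g⟩ = f g := by
  set y : X hp := ⟨f g, mem_X hp hcoc hH g⟩ with hy
  set z : X hp := ⟨(y : CompletedAlgClosure F) - Rhat hp n y, sub_mem_X hp y.2 (Rhat_mem_X hp hn y)⟩ with hz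
  have hz0 : Rhat hp n z = 0 := by
    rw [hz, Rhat_sub hp hn y ⟨Rhat hp n y, Rhat_mem_X hp hn y⟩, Rhat_Rhat hp hn, sub_self]
  have hzγ : gen hp n • (z : CompletedAlgClosure F) = z := by
    change gen hp n • (f g - Rhat hp n y) = f g - Rhat hp n y
    rw [smul_sub, gen_smul_apply_eq hp hn hcoc hH hred g, gen_smul_Rhat hp hn]
  have := eq_zero_of_Rhat_eq_zero_of_gen_smul_eq hp hn z hz0 hzγ
  change f g - Rhat hp n y = 0 at this
  exact (sub_eq_zero.mp this).symm

/-- **On powers of `γ` a reduced cocycle is linear**: `f(γ^k) = k · f(γ)`. [cite: Tate1967, §3.3 Theorem 1] -/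
theorem apply_gen_pow {n : ℕ} (hn : 2 ≤ n) (hcoc : ∀ g h : BaseGaloisGroup hp, f (g * h) = f g + g • f h)
    (hH : ∀ h : BaseGaloisGroup hp, (∀ M, h • zeta F p M = zeta F p M) → f h = 0)
    (hred : Rhat hp n ⟨f (gen hp n), mem_X hp hcoc hH _⟩ = f (gen hp n)) (k : ℕ) :
    f (gen hp n ^ k) = (k : CompletedAlgClosure F) * f (gen hp n) := by
  induction k with
  | zero => rw [pow_zero, apply_one hp hcoc, Nat.cast_zero, zero_mul]
  | succ k ih =>
    rw [pow_succ, hcoc, ih, smul_apply_gen_eq hp hn hcoc hH hred (gen hp n ^ k)]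
    push_cast
    ring

end TateH1

end Literature.NumberTheory.PAdicHodge

end
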